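import Summits.HodgeConjecture.HodgeConjecture.Theses.EndoscopicMiddleDegree
import Summits.HodgeConjecture.HodgeConjecture.Theses.SupersingularIsotypicLift
import Literature.AlgebraicGeometry.HodgeTheory.ComplexGysinCorrespondence
import Literature.AlgebraicGeometry.HodgeTheory.MotivatedClassesAlgebraic
import Literature.AlgebraicGeometry.HodgeTheory.GysinKernelProofs
import Literature.AlgebraicGeometry.HodgeTheory.RationalClassesIndependent
import Literature.AlgebraicGeometry.HodgeTheory.SupportedClassesRationalProofs

/-!
# Disproof of `IsotypicMiddleClassesAlgebraic` — standing adversary's work file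
(cdisprove `stmt-HodgeConjecture-14301`; cycle 1, 2026-08-16; refuter-cdisprove-stmt-HodgeConjecture-14301-0)

Crux (`EndoscopicMiddleDegree.IsotypicMiddleClassesAlgebraic`, rank 3, the supersingular-seeded
kernel of the route): for an orientation family `μ` with Poincaré duality, `m ∈ {1,2}`
(`dim X = 2n`, `n = m+1 ∈ {2,3}`), a datum `D : UnitaryBallQuotientDatum (2n) X`, an ALGEBRAIC
class `γ ∈ N^{2n}H^{4n}((X ⊗ X)(ℂ))` whose action `P β = pr₁₊(pr₂^*β ∪ γ)` (H2) preserves rational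
classes and (H3) has purely `(n,n)` image: every RATIONAL `c` with `P c = c` is algebraic.

VERDICT OF CYCLE 1: NO KILL, AND NO KILL IS POSSIBLE SHORT OF `¬HC` — `crux_of_hodgeConjecture :
HodgeConjecture → Crux` is PROVED below (three lines: `c = P c` is a rational `(n,n)`-class on the
smooth projective `X`, `D.isSmoothProjective`). Everything in this file is therefore STRUCTURAL:
which hypotheses carry weight, what the statement is equivalent to, and where the route's intended
PROOF (supersingular seeds ⟶ BEK lifting ⟶ ALG) provably has no seeds. Prose lives in docstrings;
every `theorem` is sorry-free (lean check rc 0, axioms ⊆ {propext, Classical.choice, Quot.sound}).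

## Findings

* **F0 — elaboration / junk audit: clean.** The inline `P` is DEFINITIONALLY the tree's
  `corrAction μ hX hX rfl γ` (`corrP_apply`, `rfl`), hence `ℂ`-linear; the degree bookkeeping
  (`6n → 2n` through `H_{2n}`, `a + 2·dim X = b + 2·dim(X ⊗ X)`) is right; `IsSmoothProjective` is
  a `Prop`, so `P` does not depend on the smoothness proof hidden in `D`; `IsOfHodgeType` is `∃` over
  Hodge models per class (harmless: H3 is only used at `β = c`); `algebraicClasses = N^p H^{2p}` with
  `Order.coheight` = codimension (generic point has coheight `0`, `coheight_genericPoint_eq_zero`).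
  No `ℕ`-subtraction, division, `sSup`, empty-`Finset` operators. The datum cannot be inhabited in the
  tree (no compact unitary Shimura variety exists as a `Scheme`; cf. `Cruxes/MiddleThetaSpan/Disproof`
  F1, which audited the same structure), so no unconditional witness against ANY variant exists here.
* **F1 — CEILING (proved): `HodgeConjecture → MiddleHC → Crux`** (`MiddleHC` := HC in the middle
  degree on the sector = the conclusion of the target `MiddleDegreeStep` without its lower-degree
  hypothesis). The proof uses NEITHER Poincaré duality of `μ`, NOR `γ ∈ algebraicClasses`, NOR H2, NOR
  `1 ≤ m ≤ 2`: all four are logically idle relative to HC (`cruxStripped_of_hodgeConjecture`,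
  `crux_of_cruxStripped`). Contrapositive `not_hodgeConjecture_of_not_crux`: a refutation of the crux
  IS a counterexample to the Hodge conjecture on a compact arithmetic 4- or 6-ball quotient. Also
  `crux_of_lift`: the sibling crux `SupersingularIsotypicLift.IsotypicClassesAlgebraic` (all `X`, all
  `p`) specialises to this one term-for-term (the planner's `isotypicMiddle_of_lift`, re-proved).
* **F2 — BARE FORM (proved): forgetting that `P` comes from `γ` gives back exactly `MiddleHC`**
  (`cruxBare_iff_middleHC`: with `P` an arbitrary function having `(n,n)` values, take `P ≡ c`). So
  ALL the slack between the crux and middle-degree HC sits in the SHAPE of `P` (a linear, algebraic,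
  `ℚ`-rational correspondence) — i.e. in the ENVELOPE question, never in the algebraicity question.
* **F3 — LOAD-BEARING ANALYSIS (proved).**
  (a) Drop H3 ⟹ the statement collapses to `AllRationalMiddleAlgebraic` ("every rational class in
  `H^{2n}(X(ℂ))` is algebraic"; `cruxWithoutHodgeImage_iff`): the diagonal `[Δ_X] = (𝟙,𝟙)_* 1` is
  algebraic (`diagClass_mem_algebraicClasses`, from the tree's `complexGysin_graph_one_mem_algebraicClasses`)
  and acts as the identity (`corrP_diagClass`, from `corrClassAction_graph`: projection formula +
  `(𝟙)_* = id`), trivially preserving rationality. `AllRationalMiddleAlgebraic` is false on every level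
  of the tower with `h^{2n,0}(X_K) ≠ 0` (algebraic classes are `(n,n)`; rational classes span
  `H^{2n}`; `h^{2n,0} = h⁰(K_X) → ∞` with the covolume by proportionality) — not formal here for want of
  a datum. So H3 is the ONE hypothesis on `P` that carries weight.
  (b) Drop `P c = c` ⟹ same collapse (`cruxWithoutFixed_iff`, `γ = 0`, modulo existence of Hodge
  models on the sector, `SectorHodgeModels`, a theorem on paper).
  (c) Drop PD, the bounds on `m`, `γ ∈ algebraicClasses` AND H2 simultaneously (`CruxStripped`) ⟹
  still a consequence of HC (`cruxStripped_of_hodgeConjecture`) and still implies the crux: none of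
  them can ever be shown necessary by a `_false_without_` witness short of `¬HC`. In particular H2
  (rationality preservation) is NOT automatic — `μ` may be rescaled by a transcendental scalar on
  `X ⊗ X` (`corrAction_eq_smul_of_orientationFamily`), making `P(H_ℚ) = t·(…)` irrational — but it is
  logically idle; it only serves the MECHANISM (it makes `N = P(H_ℚ)` a `ℚ`-structure).
  (d) `IsRationalClass c` is DECORATIVE (PROVED, `cruxComplexC_iff : CruxComplexC ↔ Crux`): `Q = P − 1`
  maps rational classes to rational classes (H2), the rational classes span `H^{2n}(X(ℂ); ℂ)`
  (`span_isRationalClass_eq_top_of_isSmoothProjective_holds`) and rational relations control complex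
  ones (`linearIndependent_iff_of_isRationalClass`), so `ker Q` is spanned by RATIONAL fixed classes
  (`mem_span_rational_ker`, via rational coordinates `exists_rat_coords` and the `ℚ`-dual trick
  `sum_smul_eq_zero_of_dual` — no finite-dimensionality of `H` needed), each algebraic by the crux.
  Equivalent, cleaner prover target (`ker_sub_id_le_algebraicClasses_of_crux`):
  **`LinearMap.ker (P - 1) ≤ algebraicClasses X (m+1)`** — the whole fixed space is algebraic.
  (e) `μ.HasPoincareDuality` is a THEOREM for every `μ` (`OrientationFamily.hasPoincareDuality`,
  `GysinKernelProofs`): the hypothesis is free (`μ₀_hasPoincareDuality`); the support item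
  `OrientationData` (stmt-2789) already carries an unconditional candidate proof (grounder g15-3).
* **F4 — FLOOR (proved): with an envelope the crux IS middle-degree HC.**
  `middleHC_of_crux_of_middleEnveloped : Crux → MiddleEnveloped → MiddleHC` (sector version of
  `SupersingularIsotypicLift.HodgeClassesEnveloped`), and the route's actual use
  `orthogonal_algebraic_of_crux : Crux → OrthogonalEnveloped → (rational (n,n)-classes cup-orthogonal
  to the theta world TW(D) are algebraic)`. Hence `Crux` is sandwiched
  `MiddleHC ⟹ Crux ⟹ (MiddleEnveloped → MiddleHC)`; its honest content is "HC for ENVELOPED middle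
  classes", and `HC ⟹ MiddleEnveloped` holds on paper (HC on `X × X` + `B ⟹ D` over `ℂ`, Lieberman),
  so over HC the three are equivalent. NOTHING in the typed statement refers to ball quotients except
  through `D.isSmoothProjective`: the datum is where the ATTACK lives, not the statement.

## Where the intended proof dies (mechanism analysis for the provers; no bearing on truth)

The route proves the crux by (S) supersingular seeds: at an inert hyperspecial prime `𝔭 | p` of
`F`, `H^{BM}_{2n}(basic locus of X̄_𝔭) ≅ C(G'(ℚ)\G'(𝔸_f)/K) ⊗ V^{Tate}_{μ*}` (Xiao–Zhu
arXiv:1707.05700 Thm 4(1), READ pp. 3–5) with injective cycle class map on `V_{μ*}`-general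
`π_{f,p}` (Thm 4(2)), plus the multiplicity comparison `a_G(A(n,n) ⊗ π_f) = m_{G'}(𝟙 ⊗ π_f)`; then
(B) Bloch–Esnault–Kerz lifting inside the algebraically cut `(n,n)`-piece; then (A) ALG.

* **M0 — bookkeeping the planner did not price.** (i) For signature `(2n,1)`, `dim V^{Tate}_{μ*} =
  binom(n,n) = 1` (Xiao–Zhu p. 4: odd unitary `(i, N−i)` at an inert prime has `binom((N−1)/2, ⌊i/2⌋)`),
  so the basic locus sees `π_f` with multiplicity EXACTLY `m_{G'}(𝟙 ⊗ π_f)` — nothing else. (ii) Thm 4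
  is stated for `(G,X)` of HODGE type with `Z_G` connected, `p > 2`, `K_p` hyperspecial; `Res_{F/ℚ} U(V)`
  with `F ≠ ℚ` (forced: `V` anisotropic of dimension `5, 7`) gives Shimura varieties of ABELIAN type —
  the transfer to `X = Γ\𝔹` needs an RSZ-type Hodge-type avatar and a connected-components / central
  leaves comparison (routine but unfiled). (iii) Thm 4(3) (surjectivity onto Tate classes) needs a
  Kottwitz variety or an auxiliary place where `π_f` is Steinberg — impossible for endoscopic
  (Tate-type) `π_f`, whose every localisation is a direct sum; the route must get spanning from
  (1)+(2) and its own dimension count, which is exactly the multiplicity comparison below.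
* **M1 — THE SEEDS CRITERION (derived this session; the decisive dichotomy).** Let `N = 2n+1`,
  `ψ = ⊞_j ψ_j` the (elliptic) Arthur parameter of a Tate-type `π_f`, trivial coefficients, `χ₀` the
  constituent carrying the archimedean weight `0` at `τ₁`, and let `G' = U(V')` be the DEFINITE twin
  with `V'_v = V_v` at every finite place (flip `τ₁ : (2n,1) → (2n+1,0)` and one other real place
  `τ₂ : (2n+1,0) → (0,2n+1)`; Landherr: exists because the two discriminant signs compensate — this
  uses `F ≠ ℚ`, automatic here). Then, by the multiplicity formula for pure inner forms (KMSW
  arXiv:1409.3731 Thm 1.7.1; `ε_ψ` is the SAME character on both sides) and Shelstad's description of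
  discrete-series Vogan packets of `U(p,q)` (two members differ, as characters of `S_{ψ_∞} = (ℤ/2)^N`,
  by `−1` exactly on the lines whose compact/non-compact side differs):
  `η_{A(n,n)} / η_{𝟙,U(N,0)} = (−1 on e₀ only)`, `η_{𝟙,U(0,N)} / η_{𝟙,U(N,0)} = det = (s ↦ (−1)^{dim M^s})`,
  whence **`m_G(A(n,n) ⊗ π_f) = m_{G'}(𝟙 ⊗ π_f)` iff `det(s) = [s flips χ₀]` on `S_ψ`, i.e. iff EVERY
  constituent `ψ_j ≠ χ₀` is EVEN-dimensional; otherwise `m_G(A(n,n) ⊗ π_f) · m_{G'}(𝟙 ⊗ π_f) = 0` for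
  every `π_f`** (classes without seeds, seeds without classes). Cross-check: flipping instead a finite
  non-split place `v₀` (`V'_{v₀} = a·V_{v₀}`, same group) relabels `π_{v₀}` by the same character `det`
  (KMSW Lemma 2.1.2, READ p. 21: `Δ[𝔢,ξ,yz] = ⟨y, s̄^𝔢⟩ Δ[𝔢,ξ,z]`, `s̄ = det s`), giving the same
  criterion — as it must, `m_{G'}` being intrinsic.
  CONSEQUENCES. ✓ `ψ = Ψ' ⊞ χ₀` with `Ψ'` cuspidal (the generic Tate type), `Ψ₂ ⊞ Ψ₂' ⊞ χ₀`,
  `Ψ₄ ⊞ Ψ₂ ⊞ χ₀` (n = 3), and the GL₂-CAP `(ρ ⊠ R₂) ⊞ χ₀` of `MiddleThetaSpan/Disproof` F7(b)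
  (Adams–Johnson packet, same flip rule block-wise): seeds exist at EVERY inert hyperspecial prime
  exactly when the class exists. ✗ `ψ` with an odd-dimensional constituent besides `χ₀` (then at
  least two): `Ψ₃ ⊞ χ₁ ⊞ χ₀`, `Ψ₂ ⊞ χ₁ ⊞ χ₂ ⊞ χ₀`, five Hecke characters (n = 2); `Ψ₅ ⊞ χ₁ ⊞ χ₀`,
  `Ψ₃ ⊞ Ψ₃' ⊞ χ₀`, … (n = 3): whenever `A(n,n) ⊗ π_f` is automorphic on `G` (a primitive Tate-type
  `(n,n)`-class on `X_K`), the `π_f`-eigenspace of `H^{BM}_{2n}(basic locus)` is ZERO at every inert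
  prime — step (S) produces nothing, at any `p`. The crux is untouched (F1); the route's proof of it
  is not. These ✗-types are genuine (CM-type constructions à la Blasius–Rogawski give rational
  Tate-type classes of exactly this shape) and can be theta-invisible at level `K` for the same
  reason as ✓-types (non-split dichotomy space at `≥ 2` places, `MiddleThetaSpan/Disproof` F3/F10),
  so they can sit in the kernel `OrthogonalEnveloped` feeds to this crux. PROVERS: either show the
  kernel contains no ✗-type rational class, or seed ✗-types differently (they are endoscopic from
  `U(N₁) × U(N₂) × …` with two odd blocks: products of special cycles of odd codimension are the
  natural candidates). PRINTED CHECK AT `n = 1` (done this cycle; Rogawski, *Automorphic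
  Representations of Unitary Groups in Three Variables*, AM-123 (1990), READ §12.3 and §14.4–14.6):
  for `G_∞ = U(2,1)` the DS packet `{D_φ, D_φ⁺, D_φ⁻}` pairs with the three endoscopic data
  `ρ = ρ(a,b,c)` (the `U(1)`-character is the MIDDLE weight), `ρ⁺ = ρ(b,a,c)`, `ρ⁻ = ρ(a,c,b)` by
  `⟨ρ,D⟩ = ⟨ρ⁺,D⟩ = ⟨ρ⁻,D⟩ = 1` (`D_φ` = the `H^{1,1}`-member sharing `i_G(χ_φ)` with `F_φ`), while at
  a COMPACT place the unique member `F_φ` has `⟨ρ,F⟩ = 1`, `⟨ρ^±,F⟩ = −1` (Prop. 14.4.2(b) and the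
  normalisation before Thm 14.6.5, `(−1)^N c = 1` absorbed); Thm 14.6.5: `m(π') = |Π̂'|⁻¹ Σ_s ⟨s,π'⟩`.
  Hence for a packet `Π(ρ)` with ONE endoscopic datum whose `U(1)`-character carries the middle
  weight (`ψ = ρ₂ ⊞ χ₀`, ✓-type) `m(D ⊗ π_f) = m(F ⊗ π_f)`; if the `U(1)`-character carries an
  extreme weight (✗: the weight-`0` constituent is the 2-dimensional one, the other is odd) or for
  the three-character packets (`|Π̂| = 4`, ✗) the conditions at `ρ^±` differ by the factor `−1`
  between `D ⊗ F^{r−1} ⊗ π_f` on `G` and `F^{r} ⊗ π_f` on `G'`, so `m · m' = 0` — exactly the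
  criterion above (Rogawski's signs differ from the Whittaker-normalised ones by `det` on single
  flips; only products over all places enter).
* **M2 — V-generality (Xiao–Zhu Def. 19 / Rem. 20: for `Ĝ = GL_{2n+1} ⋊ σ`, std, `γσ` is V-general
  iff `α_i ≠ α_{2n+2−i}` for `i ≠ n+1`, i.e. iff the base-changed Satake parameter at `w | 𝔭` has
  eigenvalue `1` with multiplicity ONE).** A conjugate-orthogonal Hecke character unramified at an
  inert `w` is LOCALLY TRIVIAL there (`χ|_{F_v^×} = 1`, `ϖ_v` is a uniformiser of `E_w`): so the
  `χ₀`-eigenvalue is the forced `1`, ✓-types with `Ψ'` tempered cuspidal are V-general away from the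
  sparse set `{w : 1 ∈ Spec Ψ'_w(Frob_w)}`, the CAP `(ρ ⊠ R₂) ⊞ χ₀` is V-general everywhere
  (`|λ| = 1 ≠ q^{±1/2}`; the planner's Rem. 20 remark is right), but EVERY ✗-type is V-general at NO
  inert prime: an odd-dimensional conjugate-orthogonal constituent `ψ_j` has `det ψ_j` conjugate-
  orthogonal, hence locally trivial at `w`, and its unramified eigenvalue multiset at `w` is closed
  under inversion and of odd size, so it contains `±1` an odd number of times with an even number of
  `−1`'s — it contains `+1`. So the eigenvalue `1` occurs twice (from `χ₀` and from `ψ_j`), the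
  `ψ_j`-line of weight `1`-eigenvalue carries an EXOTIC Tate class mod `𝔭` (Hodge type `≠ (n,n)`
  upstairs), and Thm 4(2) is unavailable. M1 and M2 fail TOGETHER on all ✗-types, and consistently
  so: when `𝟙 ⊗ π_f` IS automorphic on `G'` for a ✗-type, NO discrete-series member `D_a ⊗ π_f` is
  automorphic on `G` (`η_{D_a}/η_{𝟙(0,N)} = (−1 on e_a)·det` is non-trivial on `S_ψ` for every `a`),
  so `H^•(X)[π_f^p] = 0` and the (non-zero) `π_f`-part of `H^{BM}_{2n}(basic)` must die under `cl` —
  which Thm 4(2) forbids for V-general `π_{f,p}`; hence non-V-generality of ✗-types is forced.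
* **M3 — (B) is sound as designed.** `N := P(H_ℚ)`: `P` is a `ℚ`-rational algebraic correspondence,
  so `N_dR ⊗ ℂ = N ⊗ ℂ ⊆ H^{n,n} ⊆ Fⁿ` gives `N_dR ⊆ Fⁿ H^{2n}_dR(X_K)` (the filtration is defined over
  `K`); `N` is ENTIRELY of Tate type at every inert unramified `w` (all conjugates of `χ₀` are
  conjugate-orthogonal, hence locally trivial at `w`: Frobenius acts on `N_cris` by `q^n`); BEK needs
  `p > 2n + 6 ∈ {10, 12}` and `W = 𝒪_{E_w}` unramified — infinitely many inert `𝔭`. The purity of the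
  Hecke-cut piece (no other member of `Π_{ψ_∞}` automorphic with the same `π_f`) holds for EVERY
  tempered Tate type by the same character calculus (`η_{D_a}/η_{A(n,n)} = (−1 on e_a, e₀)` takes the
  value `−1` at `s_{χ₀}` since `χ₀` is its own constituent); for the CAP type at `m = 2` the
  planner's caveat (non-DS Adams–Johnson member sharing `π_f`) stands.
* **M4 — (A) ALG** (algebraization of pro-`K₀` classes; `SupersingularIsotypicLift` rank-2 crux) is
  the one open input; a phantom class (Costa–Sertöz computable) kills the ROUTE, not this crux.

## LANDED (Negative lane, `--supports stmt-HodgeConjecture-14301`, all ACCEPTED 2026-08-16T05:1xZ,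
axioms ⊆ {propext, Classical.choice, Quot.sound}) — ideators / planners / leads: IMPORT THESE, not this file:
* p80796 `Summits.HodgeConjecture.HodgeConjecture.Theorems.IsotypicMiddleClassesAlgebraic.Negative.NoKillShortOfHC`
  (F1/F2/F4: `not_middleHC_of_not_crux`, `not_hodgeConjecture_of_not_crux`, `not_lift_of_not_crux`,
  `mem_algebraicClasses_of_bare`, `mem_algebraicClasses_of_crux_of_enveloped`,
  `mem_algebraicClasses_of_crux_of_orthogonalEnveloped`);
* p80877 `….Negative.LoadBearing` (F3(a)(b)(c): `corrAction_diagonal_apply`,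
  `mem_algebraicClasses_of_withoutHodgeImage`, `mem_algebraicClasses_of_withoutFixed`,
  `not_hodgeConjecture_of_not_stripped`, `not_stripped_of_not_crux`);
* p80943 `….Negative.RationalFixed` (F3(d): `exists_rat_coords`, `sum_smul_eq_zero_of_dual`,
  `mem_span_rational_ker`, `mem_algebraicClasses_of_crux_of_fixed`, `ker_le_algebraicClasses_of_crux`).

## Targets (lead's stuck stubs)
None yet (`stuck_stubs = []`, no line picked). PRE-REGISTERED against the round-1 crux ideas
(`Ideas/*.md`, read 05:2xZ): (T1) `rz-adic-stratum-lift` §Why-it-bites (3) asserts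
"`m_{I_v}(𝟙 ⊗ Π_f) = m_G(A(n,n) ⊗ Π_f) = 1` at EVERY inert `v`" — TRUE for its GL₂-CAP and cuspidal
`Ψ'` cases (✓-types; the card's "labels shifted by the character non-trivial at `s_{χ₀}`" agrees with
`det` THERE), FALSE as a blanket statement: for ✗-types the relabelling character is `det`, not
`δ`, and `m · m' = 0` (M1) — a stub quantifying over all Tate-type `π_f` will be killed on a
three-character (n = 2: five-character) packet. Its LIFT(n,p) criterion `H¹(Y_Λ, N_{Y_Λ/𝒩_k}) = 0` is
untested here; the card's own `n = 1` count (`h¹ = g − 1 − C·C > 0`) predicts the crude criterion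
fails. (T2) `hecke-self-correlation-detectors`: its mod-`𝔭` certificate needs an eigenvector
`(a_Λ)` for `π` on the Shimura set of `G'`, which EXISTS iff `m_{G'}(𝟙 ⊗ π_f) ≥ 1` — absent for
✗-type pieces (M1); the archimedean (`δ_π(N)`) and theta certificates are unaffected. (T3)
`hodge-index-left-inverse`: `SweepExists`/`TateConiveau` is crux-strength for the piece (implied by
HC, implies the crux by the card's inversion lemma, whose Hodge–Riemann signs check out:
`⟨ℓ^{d−2}a, a⟩ < 0` on real primitive `(1,1)`); not attackable short of `¬HC`. Any future stub
asserting seeds for ALL Tate-type `π_f`, or V-generality for all Tate-type `π_p`, is false by M1/M2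
and will be attacked first.

## What was used from sibling work files
`Cruxes/MiddleThetaSpan/Disproof.lean` (cycles 1–3): F1 (datum audit), F2 (A(n,n) = DS with the `0`
in the `U(1)`-slot), F5 (cores carry no rational class short of ¬HC), F7 (which packets carry
`A(2,2)`), F10 (where theta-invisibility lives). Nothing imported formally.
-/

noncomputable section

set_option linter.dupNamespace false

namespace Summit.HodgeConjecture.HodgeConjecture.Cruxes.IsotypicMiddleClassesAlgebraic.Disproof

open CategoryTheory MonoidalCategory CartesianMonoidalCategory
open Literature.AlgebraicGeometry Literature.AlgebraicGeometry.HodgeTheory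
open Literature.AlgebraicGeometry.ShimuraVarieties Literature.AlgebraicTopology.SingularHomology
open Summit.HodgeConjecture.HodgeConjecture.Theses
open Submodule

/-! ### §0 The crux, and its correspondence action named -/

/-- The crux under attack: `EndoscopicMiddleDegree.IsotypicMiddleClassesAlgebraic`
(stmt-HodgeConjecture-14301). -/
abbrev Crux : Prop := EndoscopicMiddleDegree.IsotypicMiddleClassesAlgebraic

variable {m n : ℕ} {X : Motives.SchemeOver ℂ}

/-- The correspondence action of the crux, NAMED: `corrP μ D γ := corrAction μ hX hX rfl γ`
(`pr₁₊(pr₂^* – ∪ γ)`, the tree's `ComplexGysinCorrespondence.corrAction`), a `ℂ`-linear map. -/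
abbrev corrP (μ : OrientationFamily) (D : UnitaryBallQuotientDatum (2 * (m + 1)) X)
    (γ : complexBetti (X ⊗ X) (2 * (2 * (m + 1)))) :
    complexBetti X (2 * (m + 1)) →ₗ[ℂ] complexBetti X (2 * (m + 1)) :=
  corrAction μ D.isSmoothProjective D.isSmoothProjective
    (rfl : 2 * (m + 1) + 2 * (2 * (m + 1)) = 2 * (m + 1) + 2 * (2 * (m + 1))) γ

/-- F0: the inline `P` of the crux IS `corrP μ D γ`, by `rfl` (so `P` is linear, and every tree lemma
about `corrAction` applies to it verbatim). -/
theorem corrP_apply (μ : OrientationFamily) (D : UnitaryBallQuotientDatum (2 * (m + 1)) X)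
    (γ : complexBetti (X ⊗ X) (2 * (2 * (m + 1)))) (β : complexBetti X (2 * (m + 1))) :
    corrP μ D γ β =
      complexGysin μ (Motives.IsSmoothProjective.tensor_holds D.isSmoothProjective D.isSmoothProjective)
        D.isSmoothProjective (fst X X)
        (show 2 * (m + 1) + 2 * (2 * (m + 1)) + 2 * (2 * (m + 1)) =
          2 * (m + 1) + 2 * (2 * (m + 1) + 2 * (m + 1)) by ring)
        (cupProduct (rfl : 2 * (m + 1) + 2 * (2 * (m + 1)) = 2 * (m + 1) + 2 * (2 * (m + 1)))
          (complexBetti.map (snd X X) (2 * (m + 1)) β) γ) :=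
  rfl

/-- A fixed orientation family (every `X(ℂ)` is `ℂ`-orientable: `Motives.ComplexPoints.isOrientableOver`). -/
def μ₀ : OrientationFamily := fun _ _ h ↦ Classical.choice (Motives.ComplexPoints.isOrientableOver ℂ h)

/-- F3(e): Poincaré duality is a THEOREM for every orientation family; the crux's hypothesis
`μ.HasPoincareDuality` is free. -/
theorem μ₀_hasPoincareDuality : μ₀.HasPoincareDuality := OrientationFamily.hasPoincareDuality _

/-! ### §1 Ceiling: the crux is a consequence of the Hodge conjecture (F1) -/

/-- Middle-degree Hodge conjecture ON THE SECTOR: every rational `(n,n)`-class in `H^{2n}` of a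
`2n`-dimensional `X` carrying a `UnitaryBallQuotientDatum`, `n = m+1 ∈ {2,3}`, is algebraic — the
conclusion of the route's target `MiddleDegreeStep` WITHOUT its lower-degree hypothesis. -/
def MiddleHC : Prop :=
  ∀ (m : ℕ) (X : Motives.SchemeOver ℂ), UnitaryBallQuotientDatum (2 * (m + 1)) X → 1 ≤ m → m ≤ 2 →
    ∀ c : complexBetti X (2 * (m + 1)), IsRationalClass c →
      IsOfHodgeType (2 * (m + 1)) X (2 * (m + 1)) (m + 1) (m + 1) c → c ∈ algebraicClasses X (m + 1)

/-- `HC ⟹ MiddleHC` (the datum's `X` is smooth projective of dimension `2(m+1)`). -/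
theorem middleHC_of_hodgeConjecture (h : _root_.HodgeConjecture) : MiddleHC :=
  fun m _X D _ _ c hc hH ↦ (h D.isSmoothProjective).2 (m + 1) c hc hH

/-- **F1, the ceiling: `MiddleHC ⟹ Crux`.** `c = P c` is of type `(n,n)` by H3 at `β = c`, and
rational; NOTHING about `μ`, `γ`, H2 or the bounds on `m` is used. -/
theorem crux_of_middleHC (h : MiddleHC) : Crux := by
  intro μ _hμ m X D h1 h2 γ _hγ P _hPrat hPhodge c hc hPc
  exact h m X D h1 h2 c hc (hPc ▸ hPhodge c)

/-- **F1: `HodgeConjecture ⟹ Crux`.** No unconditional refutation of the crux exists short of `¬HC`. -/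
theorem crux_of_hodgeConjecture (h : _root_.HodgeConjecture) : Crux :=
  crux_of_middleHC (middleHC_of_hodgeConjecture h)

/-- F1, contrapositive: a kill of the crux is a counterexample to the Hodge conjecture (on a compact
arithmetic ball-quotient 4- or 6-fold, in the middle degree). -/
theorem not_hodgeConjecture_of_not_crux (h : ¬ Crux) : ¬ _root_.HodgeConjecture :=
  fun hHC ↦ h (crux_of_hodgeConjecture hHC)

/-- F1, contrapositive on the sector: a kill of the crux kills middle-degree HC on the sector, i.e.
exhibits a non-algebraic rational `(2,2)`- or `(3,3)`-class on a compact `U(4,1)`/`U(6,1)` quotient. -/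
theorem not_middleHC_of_not_crux (h : ¬ Crux) : ¬ MiddleHC :=
  fun hM ↦ h (crux_of_middleHC hM)

/-- F1: the sibling crux `SupersingularIsotypicLift.IsotypicClassesAlgebraic` (LIFT: all smooth
projective `X`, all `p`) specialises term-for-term to this crux (the planner's
`isotypicMiddle_of_lift`). -/
theorem crux_of_lift (h : SupersingularIsotypicLift.IsotypicClassesAlgebraic) : Crux := by
  intro μ hμ m X D _h1 _h2 γ hγ
  exact h μ hμ D.isSmoothProjective (m + 1) γ hγ

/-- Hence a kill of this crux also kills LIFT. -/
theorem not_lift_of_not_crux (h : ¬ Crux) : ¬ SupersingularIsotypicLift.IsotypicClassesAlgebraic :=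
  fun hL ↦ h (crux_of_lift hL)

/-! ### §2 The bare form: all slack is in the shape of `P` (F2) -/

/-- The BARE crux: `P` an ARBITRARY function `H^{2n} → H^{2n}` with `(n,n)` values (no `γ`, no
linearity, no rationality preservation). -/
def CruxBare : Prop :=
  ∀ (m : ℕ) (X : Motives.SchemeOver ℂ), UnitaryBallQuotientDatum (2 * (m + 1)) X → 1 ≤ m → m ≤ 2 →
    ∀ P : complexBetti X (2 * (m + 1)) → complexBetti X (2 * (m + 1)),
      (∀ β, IsOfHodgeType (2 * (m + 1)) X (2 * (m + 1)) (m + 1) (m + 1) (P β)) →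
        ∀ c, IsRationalClass c → P c = c → c ∈ algebraicClasses X (m + 1)

/-- **F2: `CruxBare ↔ MiddleHC`** (`→`: the constant function `P ≡ c` envelopes `c`). -/
theorem cruxBare_iff_middleHC : CruxBare ↔ MiddleHC := by
  constructor
  · intro h m X D h1 h2 c hc hH
    exact h m X D h1 h2 (fun _ ↦ c) (fun _ ↦ hH) c hc rfl
  · intro h m X D h1 h2 P hP c hc hPc
    exact h m X D h1 h2 c hc (hPc ▸ hP c)

/-- F2: the crux is the bare form restricted to correspondence-shaped `P`. -/
theorem crux_of_cruxBare (h : CruxBare) : Crux := by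
  intro μ _hμ m X D h1 h2 γ _hγ P _hPrat hPhodge c hc hPc
  exact h m X D h1 h2 P hPhodge c hc hPc

/-! ### §3 Load-bearing analysis (F3) -/

/-- The diagonal class `[Δ_X] := (𝟙, 𝟙)_* 1 ∈ H^{2n}((X ⊗ X)(ℂ); ℂ)` (`dim X = n`). -/
def diagClass (μ : OrientationFamily) (hX : Motives.IsSmoothProjective n X) :
    complexBetti (X ⊗ X) (2 * n) :=
  complexGysin μ hX (Motives.IsSmoothProjective.tensor_holds hX hX) (lift (𝟙 X) (𝟙 X))
    (show 0 + 2 * (n + n) = 2 * n + 2 * n by omega)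
    (singularCohomology.one ℂ (Motives.ComplexPoints X))

/-- `[Δ_X]` is algebraic: `[Δ_X] ∈ Nⁿ H^{2n}((X ⊗ X)(ℂ))` (graph of the identity;
`complexGysin_graph_one_mem_algebraicClasses`). -/
theorem diagClass_mem_algebraicClasses (μ : OrientationFamily) (hX : Motives.IsSmoothProjective n X) :
    diagClass μ hX ∈ algebraicClasses (X ⊗ X) n :=
  complexGysin_graph_one_mem_algebraicClasses μ μ.hasPoincareDuality hX _ (𝟙 X)

/-- `[Δ_X]_* = id` on `Hᵃ(X(ℂ); ℂ)` for `a ≤ 2 dim X` (`corrClassAction_graph` at `f = 𝟙`: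
projection formula, `(𝟙,𝟙) ≫ pr₁ = 𝟙`, `(𝟙)_* = id`). -/
theorem corrAction_diagClass (μ : OrientationFamily) (hX : Motives.IsSmoothProjective n X) {a : ℕ}
    (ha : a ≤ 2 * n) (c : complexBetti X a) :
    corrAction μ hX hX (rfl : a + 2 * n = a + 2 * n) (diagClass μ hX) c = c := by
  have hq : a + (2 * n - a) = 2 * n := by omega
  rw [corrAction_eq_corrClassAction μ hX hX rfl hq]
  have h := corrClassAction_graph μ μ.hasPoincareDuality hX
    (Motives.IsSmoothProjective.tensor_holds hX hX) (𝟙 X) hq c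
  rw [complexBetti.map_id] at h
  exact h

/-- The crux's `P` for `γ = [Δ_X]` is the identity of `H^{2n}(X(ℂ); ℂ)`. -/
theorem corrP_diagClass (μ : OrientationFamily) (D : UnitaryBallQuotientDatum (2 * (m + 1)) X)
    (β : complexBetti X (2 * (m + 1))) :
    corrP μ D (diagClass μ D.isSmoothProjective) β = β :=
  corrAction_diagClass μ D.isSmoothProjective (by omega) β

/-- The crux WITHOUT H3 (the `(n,n)`-image hypothesis); everything else kept. -/
def CruxWithoutHodgeImage : Prop :=
  ∀ (μ : OrientationFamily), μ.HasPoincareDuality → ∀ (m : ℕ) (X : Motives.SchemeOver ℂ)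
    (D : UnitaryBallQuotientDatum (2 * (m + 1)) X), 1 ≤ m → m ≤ 2 →
    ∀ γ ∈ algebraicClasses (X ⊗ X) (2 * (m + 1)),
      (∀ β, IsRationalClass β → IsRationalClass (corrP μ D γ β)) →
        ∀ c, IsRationalClass c → corrP μ D γ c = c → c ∈ algebraicClasses X (m + 1)

/-- "EVERY rational class in the middle degree of the sector is algebraic" — false at every level
with `h^{2n,0}(X_K) ≠ 0` (algebraic classes are of type `(n,n)`, rational classes span `H^{2n}`),
i.e. eventually in every congruence tower (`h^{2n,0} = m(D_{hol}, Γ_K)` grows like the covolume by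
limit multiplicity, de George–Wallach 1978); not formally refutable here (no datum is constructible
in the tree). -/
def AllRationalMiddleAlgebraic : Prop :=
  ∀ (m : ℕ) (X : Motives.SchemeOver ℂ), UnitaryBallQuotientDatum (2 * (m + 1)) X → 1 ≤ m → m ≤ 2 →
    ∀ c : complexBetti X (2 * (m + 1)), IsRationalClass c → c ∈ algebraicClasses X (m + 1)

/-- **F3(a): dropping H3 collapses the crux to `AllRationalMiddleAlgebraic`** (witness `γ = [Δ_X]`,
`P = id`, which preserves rationality). H3 is the load-bearing hypothesis on `P`. -/
theorem cruxWithoutHodgeImage_iff : CruxWithoutHodgeImage ↔ AllRationalMiddleAlgebraic := by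
  constructor
  · intro h m X D h1 h2 c hc
    refine h μ₀ μ₀_hasPoincareDuality m X D h1 h2 (diagClass μ₀ D.isSmoothProjective)
      (diagClass_mem_algebraicClasses μ₀ D.isSmoothProjective) (fun β hβ ↦ ?_) c hc ?_
    · rwa [corrP_diagClass]
    · rw [corrP_diagClass]
  · intro h μ _ m X D h1 h2 γ _ _ c hc _
    exact h m X D h1 h2 c hc

/-- The crux WITHOUT `P c = c`; everything else kept. -/
def CruxWithoutFixed : Prop :=
  ∀ (μ : OrientationFamily), μ.HasPoincareDuality → ∀ (m : ℕ) (X : Motives.SchemeOver ℂ)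
    (D : UnitaryBallQuotientDatum (2 * (m + 1)) X), 1 ≤ m → m ≤ 2 →
    ∀ γ ∈ algebraicClasses (X ⊗ X) (2 * (m + 1)),
      (∀ β, IsRationalClass β → IsRationalClass (corrP μ D γ β)) →
        (∀ β, IsOfHodgeType (2 * (m + 1)) X (2 * (m + 1)) (m + 1) (m + 1) (corrP μ D γ β)) →
          ∀ c, IsRationalClass c → c ∈ algebraicClasses X (m + 1)

/-- Hodge models exist on the sector (Serre GAGA + de Rham + Hodge decomposition: a theorem on
paper, a named-fact package in the tree; hypothesis here). -/
def SectorHodgeModels : Prop :=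
  ∀ (m : ℕ) (X : Motives.SchemeOver ℂ), UnitaryBallQuotientDatum (2 * (m + 1)) X →
    Nonempty (HodgeModel (2 * (m + 1)) X)

/-- **F3(b): dropping `P c = c` collapses the crux to `AllRationalMiddleAlgebraic`** (witness
`γ = 0`, `P = 0`), modulo Hodge models on the sector. -/
theorem cruxWithoutFixed_iff (hM : SectorHodgeModels) :
    CruxWithoutFixed ↔ AllRationalMiddleAlgebraic := by
  constructor
  · intro h m X D h1 h2 c hc
    obtain ⟨A⟩ := hM m X D
    have h0 : corrP μ₀ D (0 : complexBetti (X ⊗ X) (2 * (2 * (m + 1)))) = 0 := map_zero _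
    refine h μ₀ μ₀_hasPoincareDuality m X D h1 h2 0 (Submodule.zero_mem _) (fun β _ ↦ ?_)
      (fun β ↦ ?_) c hc
    · rw [h0, LinearMap.zero_apply]; exact IsRationalClass.zero
    · rw [h0, LinearMap.zero_apply]; exact IsOfHodgeType.zero A _ _ _
  · intro h μ _ m X D h1 h2 γ _ _ _ c hc
    exact h m X D h1 h2 c hc

/-- The STRIPPED crux: no Poincaré duality, no bounds on `m`, `γ` ANY class in `H^{4n}((X ⊗ X)(ℂ))`
(not necessarily algebraic), no rationality preservation — only H3, rationality of `c`, `P c = c`. -/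
def CruxStripped : Prop :=
  ∀ (μ : OrientationFamily) (m : ℕ) (X : Motives.SchemeOver ℂ)
    (D : UnitaryBallQuotientDatum (2 * (m + 1)) X) (γ : complexBetti (X ⊗ X) (2 * (2 * (m + 1)))),
      (∀ β, IsOfHodgeType (2 * (m + 1)) X (2 * (m + 1)) (m + 1) (m + 1) (corrP μ D γ β)) →
        ∀ c, IsRationalClass c → corrP μ D γ c = c → c ∈ algebraicClasses X (m + 1)

/-- Middle-degree HC on ball quotients of EVERY even dimension `2(m+1)`. -/
def MiddleHCAll : Prop :=
  ∀ (m : ℕ) (X : Motives.SchemeOver ℂ), UnitaryBallQuotientDatum (2 * (m + 1)) X →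
    ∀ c : complexBetti X (2 * (m + 1)), IsRationalClass c →
      IsOfHodgeType (2 * (m + 1)) X (2 * (m + 1)) (m + 1) (m + 1) c → c ∈ algebraicClasses X (m + 1)

theorem middleHCAll_of_hodgeConjecture (h : _root_.HodgeConjecture) : MiddleHCAll :=
  fun m _X D c hc hH ↦ (h D.isSmoothProjective).2 (m + 1) c hc hH

theorem cruxStripped_of_middleHCAll (h : MiddleHCAll) : CruxStripped :=
  fun _μ m X D _γ hP c hc hPc ↦ h m X D c hc (hPc ▸ hP c)

/-- **F3(c): even the stripped crux follows from HC** — so PD, the bounds on `m`,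
`γ ∈ algebraicClasses` and H2 can never be shown necessary short of `¬HC`. -/
theorem cruxStripped_of_hodgeConjecture (h : _root_.HodgeConjecture) : CruxStripped :=
  cruxStripped_of_middleHCAll (middleHCAll_of_hodgeConjecture h)

/-- … and the stripped crux implies the crux. -/
theorem crux_of_cruxStripped (h : CruxStripped) : Crux := by
  intro μ _ m X D _ _ γ _ P _ hP c hc hPc
  exact h μ m X D γ hP c hc hPc


/-! ### §3d `IsRationalClass c` is decorative (F3(d)): the fixed space of `P` is spanned by
rational fixed classes -/

section RationalFixed

universe u
variable {Y : Type u} [TopologicalSpace Y] {k : ℕ}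



theorem isRationalClass_neg {c : singularCohomology ℂ ℂ Y k} (hc : IsRationalClass c) :
    IsRationalClass (-c) := by
  have h := hc.smul (-1)
  rwa [Rat.cast_neg, Rat.cast_one, neg_one_smul] at h

theorem isRationalClass_sub {c c' : singularCohomology ℂ ℂ Y k} (hc : IsRationalClass c)
    (hc' : IsRationalClass c') : IsRationalClass (c - c') := by
  rw [sub_eq_add_neg]; exact hc.add (isRationalClass_neg hc')

theorem isRationalClass_sum_smul {ι : Type*} (s : Finset ι) (q : ι → ℚ)
    (b : ι → singularCohomology ℂ ℂ Y k) (hb : ∀ i ∈ s, IsRationalClass (b i)) :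
    IsRationalClass (∑ i ∈ s, ((q i : ℚ) : ℂ) • b i) := by
  classical
  induction s using Finset.induction_on with
  | empty => rw [Finset.sum_empty]; exact IsRationalClass.zero
  | insert a s ha ih =>
    rw [Finset.sum_insert ha]
    exact ((hb a (Finset.mem_insert_self a s)).smul (q a)).add
      (ih fun i hi ↦ hb i (Finset.mem_insert_of_mem hi))

/-- Lemma A: rational coordinates. -/
theorem exists_rat_coords {ι : Type*} [Fintype ι] {b : ι → singularCohomology ℂ ℂ Y k}
    (hb : ∀ j, IsRationalClass (b j)) (hind : LinearIndependent ℂ b)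
    {x : singularCohomology ℂ ℂ Y k} (hx : IsRationalClass x) (hxs : x ∈ span ℂ (Set.range b)) :
    ∃ q : ι → ℚ, x = ∑ j, ((q j : ℚ) : ℂ) • b j := by
  classical
  set b' : Option ι → singularCohomology ℂ ℂ Y k := fun o ↦ o.elim x b with hb'def
  have hb' : ∀ o, IsRationalClass (b' o) := by
    rintro (_ | j)
    · exact hx
    · exact hb j
  have hcomp : (b' ∘ ((↑) : ι → Option ι)) = b := by
    funext j; rfl
  have hdep : ¬ LinearIndependent ℂ b' := by
    intro h
    have h2 := (linearIndependent_option.1 h).2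
    rw [hcomp] at h2
    exact h2 hxs
  rw [linearIndependent_iff_of_isRationalClass hb'] at hdep
  push Not at hdep
  obtain ⟨q, hq, hq0⟩ := hdep
  rw [Fintype.sum_option] at hq
  have hqn : q none ≠ 0 := by
    intro h0
    apply hq0
    have hrel : ∑ j, ((q (some j) : ℚ) : ℂ) • b j = 0 := by
      simpa [h0, hb'def] using hq
    have hz : ∀ j, q (some j) = 0 := fun j ↦ by
      have := Fintype.linearIndependent_iff.1 hind (fun j ↦ ((q (some j) : ℚ) : ℂ)) hrel j
      exact_mod_cast this
    funext o
    cases o with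
    | none => exact h0
    | some j => exact hz j
  refine ⟨fun j ↦ -(q (some j)) / q none, ?_⟩
  have hx' : ((q none : ℚ) : ℂ) • x = -∑ j, ((q (some j) : ℚ) : ℂ) • b j := by
    rw [eq_neg_iff_add_eq_zero]
    simpa [hb'def] using hq
  have hqnC : ((q none : ℚ) : ℂ) ≠ 0 := by exact_mod_cast hqn
  calc x = ((q none : ℚ) : ℂ)⁻¹ • (((q none : ℚ) : ℂ) • x) := by
        rw [smul_smul, inv_mul_cancel₀ hqnC, one_smul]
    _ = ∑ j, (((-(q (some j)) / q none : ℚ) : ℂ)) • b j := by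
        rw [hx', ← Finset.sum_neg_distrib, Finset.smul_sum]
        refine Finset.sum_congr rfl fun j _ ↦ ?_
        rw [← neg_smul, smul_smul]
        congr 1
        push_cast
        ring

/-- Key: complex relations among rational classes survive every `ℚ`-linear functional `ℂ → ℚ`. -/
theorem sum_smul_eq_zero_of_dual {ι : Type*} (s : Finset ι) (y : ι → singularCohomology ℂ ℂ Y k)
    (hy : ∀ i ∈ s, IsRationalClass (y i)) (lam : ι → ℂ) (h : ∑ i ∈ s, lam i • y i = 0)
    (φ : ℂ →ₗ[ℚ] ℚ) : ∑ i ∈ s, ((φ (lam i) : ℚ) : ℂ) • y i = 0 := by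
  classical
  -- an independent rational family `b` spanning the `y i`, `i ∈ s`
  set S : Finset (singularCohomology ℂ ℂ Y k) := s.image y with hSdef
  obtain ⟨t, hts, -, htspan, htind⟩ :=
    Submodule.exists_finset_span_eq_linearIndepOn ℂ (S : Set (singularCohomology ℂ ℂ Y k))
  set b : ↥(↑t : Set (singularCohomology ℂ ℂ Y k)) → singularCohomology ℂ ℂ Y k :=
    Subtype.val with hbdef
  have hb : ∀ j, IsRationalClass (b j) := by
    rintro ⟨x, hx⟩
    obtain ⟨i, hi, rfl⟩ := Finset.mem_image.1 (hts hx)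
    exact hy i hi
  have hind : LinearIndependent ℂ b := htind
  have hrange : Set.range b = (t : Set _) := Subtype.range_coe
  -- rational coordinates of each `y i` in `b`
  have hyi : ∀ i ∈ s, ∃ q : ↥(↑t : Set (singularCohomology ℂ ℂ Y k)) → ℚ,
      y i = ∑ j, ((q j : ℚ) : ℂ) • b j := by
    intro i hi
    refine exists_rat_coords hb hind (hy i hi) ?_
    rw [hrange, htspan]
    exact subset_span (Finset.mem_image_of_mem y hi)
  choose! a ha using hyi
  -- the complex coefficients of the relation vanish
  have hcoef : ∀ j, ∑ i ∈ s, lam i * ((a i j : ℚ) : ℂ) = 0 := by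
    have hsum : ∑ j, (∑ i ∈ s, lam i * ((a i j : ℚ) : ℂ)) • b j = 0 := by
      rw [← h]
      simp_rw [Finset.sum_smul, mul_smul]
      rw [Finset.sum_comm]
      refine Finset.sum_congr rfl fun i hi ↦ ?_
      rw [← Finset.smul_sum, ← ha i hi]
    exact fun j ↦ Fintype.linearIndependent_iff.1 hind _ hsum j
  -- apply `φ`
  have hcoefφ : ∀ j, ∑ i ∈ s, φ (lam i) * a i j = 0 := by
    intro j
    have h1 : φ (∑ i ∈ s, lam i * ((a i j : ℚ) : ℂ)) = ∑ i ∈ s, φ (lam i) * a i j := by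
      rw [map_sum]
      refine Finset.sum_congr rfl fun i _ ↦ ?_
      rw [show lam i * ((a i j : ℚ) : ℂ) = (a i j : ℚ) • lam i by
        rw [Rat.smul_def, mul_comm], map_smul, smul_eq_mul, mul_comm]
    rw [← h1, hcoef j, map_zero]
  -- reassemble
  calc ∑ i ∈ s, ((φ (lam i) : ℚ) : ℂ) • y i
      = ∑ i ∈ s, ((φ (lam i) : ℚ) : ℂ) • ∑ j, ((a i j : ℚ) : ℂ) • b j :=
        Finset.sum_congr rfl fun i hi ↦ by rw [← ha i hi]
    _ = ∑ j, (∑ i ∈ s, ((φ (lam i) : ℚ) : ℂ) * ((a i j : ℚ) : ℂ)) • b j := by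
        simp_rw [Finset.smul_sum, smul_smul, Finset.sum_smul]
        rw [Finset.sum_comm]
    _ = 0 := by
        refine Finset.sum_eq_zero fun j _ ↦ ?_
        rw [show (∑ i ∈ s, ((φ (lam i) : ℚ) : ℂ) * ((a i j : ℚ) : ℂ)) =
          (((∑ i ∈ s, φ (lam i) * a i j : ℚ)) : ℂ) by push_cast; rfl, hcoefφ j]
        simp




/-- MAIN (abstract): if the rational classes span `Hᵏ(Y; ℂ)` and a `ℂ`-linear endomorphism `Q`
maps rational classes to rational classes, then `ker Q` is spanned by RATIONAL elements of `ker Q`. -/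
theorem mem_span_rational_ker (hspan : span ℂ {x : singularCohomology ℂ ℂ Y k | IsRationalClass x} = ⊤)
    (Q : singularCohomology ℂ ℂ Y k →ₗ[ℂ] singularCohomology ℂ ℂ Y k)
    (hQ : ∀ β, IsRationalClass β → IsRationalClass (Q β)) {c : singularCohomology ℂ ℂ Y k}
    (hc : Q c = 0) :
    c ∈ span ℂ {x : singularCohomology ℂ ℂ Y k | IsRationalClass x ∧ Q x = 0} := by
  classical
  -- write `c` on finitely many rational classes: `c = Σ_{t ∈ T} f t • t`
  have hc' : c ∈ span ℂ {x : singularCohomology ℂ ℂ Y k | IsRationalClass x} := by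
    rw [hspan]; exact mem_top
  obtain ⟨T, hTR, hcT⟩ := mem_span_finite_of_mem_span hc'
  obtain ⟨f, -, hf⟩ := mem_span_finset.1 hcT
  -- the relation `Σ_t f t • Q t = 0`
  have hrel : ∑ t ∈ T, f t • Q t = 0 := by
    have h1 := congrArg Q hf
    rw [map_sum, hc] at h1
    simpa only [map_smul] using h1
  -- coordinates of the coefficients `f t` over `ℚ`: `E = span_ℚ {f t}` with a basis, and
  -- `ℚ`-linear functionals `φ_u : ℂ → ℚ` reading them off
  set E : Submodule ℚ ℂ := span ℚ (↑(T.image f) : Set ℂ) with hEdef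
  haveI : Module.Finite ℚ E := Module.Finite.span_of_finite ℚ (Finset.finite_toSet _)
  set bE := Module.finBasis ℚ E with hbEdef
  obtain ⟨g, hg⟩ := E.subtype.exists_leftInverse_of_injective E.ker_subtype
  have hgE : ∀ e : E, g (e : ℂ) = e := fun e ↦ LinearMap.congr_fun hg e
  set φ : Fin (Module.finrank ℚ E) → ℂ →ₗ[ℚ] ℚ := fun u ↦ (bE.coord u).comp g with hφdef
  have hft : ∀ t ∈ T, f t = ∑ u, ((φ u (f t) : ℚ) : ℂ) * (bE u : ℂ) := by
    intro t ht
    have hmem : f t ∈ E := subset_span (Finset.mem_coe.2 (Finset.mem_image_of_mem f ht))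
    have h1 := bE.sum_repr ⟨f t, hmem⟩
    have h2 := congrArg (Submodule.subtype E) h1
    rw [map_sum] at h2
    simp only [Submodule.subtype_apply, SetLike.val_smul] at h2
    have hφu : ∀ u, φ u (f t) = bE.repr ⟨f t, hmem⟩ u := fun u ↦ by
      change (bE.coord u) (g ((⟨f t, hmem⟩ : E) : ℂ)) = _
      rw [hgE]
      rfl
    calc f t = ∑ u, (bE.repr ⟨f t, hmem⟩ u) • ((bE u : E) : ℂ) := h2.symm
      _ = ∑ u, ((φ u (f t) : ℚ) : ℂ) * (bE u : ℂ) :=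
          Finset.sum_congr rfl fun u _ ↦ by rw [hφu, Rat.smul_def]
  -- the rational kernel classes `c_u := Σ_t φ_u(f t) • t`
  set cu : Fin (Module.finrank ℚ E) → singularCohomology ℂ ℂ Y k :=
    fun u ↦ ∑ t ∈ T, ((φ u (f t) : ℚ) : ℂ) • t with hcudef
  have hcu_rat : ∀ u, IsRationalClass (cu u) := fun u ↦
    isRationalClass_sum_smul T (fun t ↦ φ u (f t)) id fun t ht ↦ hTR ht
  have hcu_ker : ∀ u, Q (cu u) = 0 := by
    intro u
    rw [hcudef]
    simp only [map_sum, map_smul]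
    exact sum_smul_eq_zero_of_dual T (fun t ↦ Q t) (fun t ht ↦ hQ t (hTR ht)) f hrel (φ u)
  -- `c = Σ_u e_u • c_u`
  have hc_eq : c = ∑ u, (bE u : ℂ) • cu u := by
    rw [← hf]
    calc ∑ t ∈ T, f t • t = ∑ t ∈ T, (∑ u, ((φ u (f t) : ℚ) : ℂ) * (bE u : ℂ)) • t :=
          Finset.sum_congr rfl fun t ht ↦ by rw [← hft t ht]
      _ = ∑ u, (bE u : ℂ) • cu u := by
          simp_rw [hcudef, Finset.sum_smul, Finset.smul_sum, smul_smul]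
          rw [Finset.sum_comm]
          refine Finset.sum_congr rfl fun u _ ↦ Finset.sum_congr rfl fun t _ ↦ ?_
          rw [mul_comm]
  rw [hc_eq]
  exact sum_mem fun u _ ↦ smul_mem _ _ (subset_span ⟨hcu_rat u, hcu_ker u⟩)


end RationalFixed

/-- The crux for ALL complex classes `c` (drop `IsRationalClass c`). -/
def CruxComplexC : Prop :=
  ∀ (μ : OrientationFamily), μ.HasPoincareDuality → ∀ (m : ℕ) (X : Motives.SchemeOver ℂ)
    (D : UnitaryBallQuotientDatum (2 * (m + 1)) X), 1 ≤ m → m ≤ 2 →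
    ∀ γ ∈ algebraicClasses (X ⊗ X) (2 * (m + 1)),
      (∀ β, IsRationalClass β → IsRationalClass (corrP μ D γ β)) →
        (∀ β, IsOfHodgeType (2 * (m + 1)) X (2 * (m + 1)) (m + 1) (m + 1) (corrP μ D γ β)) →
          ∀ c, corrP μ D γ c = c → c ∈ algebraicClasses X (m + 1)

/-- **F3(d): the crux implies its version for ALL complex fixed classes** — `IsRationalClass c` is
decorative. Proof: `Q := P - 1` maps rational classes to rational classes, the rational classes
span `H^{2n}(X(ℂ); ℂ)` (`span_isRationalClass_eq_top_of_isSmoothProjective_holds`), so `ker Q` is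
spanned by rational fixed classes (`mem_span_rational_ker`), each algebraic by the crux. Equivalent
prover target: `LinearMap.ker (P - 1) ≤ algebraicClasses X (m+1)`. -/
theorem fixed_mem_algebraicClasses_of_crux (h : Crux) (μ : OrientationFamily)
    (hμ : μ.HasPoincareDuality) (m : ℕ) (X : Motives.SchemeOver ℂ)
    (D : UnitaryBallQuotientDatum (2 * (m + 1)) X) (h1 : 1 ≤ m) (h2 : m ≤ 2)
    (γ : complexBetti (X ⊗ X) (2 * (2 * (m + 1)))) (hγ : γ ∈ algebraicClasses (X ⊗ X) (2 * (m + 1)))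
    (hrat : ∀ β, IsRationalClass β → IsRationalClass (corrP μ D γ β))
    (hhodge : ∀ β, IsOfHodgeType (2 * (m + 1)) X (2 * (m + 1)) (m + 1) (m + 1) (corrP μ D γ β))
    (c : complexBetti X (2 * (m + 1))) (hc : corrP μ D γ c = c) :
    c ∈ algebraicClasses X (m + 1) := by
  set Q : complexBetti X (2 * (m + 1)) →ₗ[ℂ] complexBetti X (2 * (m + 1)) :=
    corrP μ D γ - LinearMap.id with hQdef
  have hQ : ∀ β, IsRationalClass β → IsRationalClass (Q β) := fun β hβ ↦ by
    rw [hQdef, LinearMap.sub_apply, LinearMap.id_apply]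
    exact isRationalClass_sub (hrat β hβ) hβ
  have hcQ : Q c = 0 := by
    rw [hQdef, LinearMap.sub_apply, LinearMap.id_apply, hc, sub_self]
  have hspan := span_isRationalClass_eq_top_of_isSmoothProjective_holds (2 * (m + 1)) X
    D.isSmoothProjective (2 * (m + 1))
  refine (span_le.2 ?_) (mem_span_rational_ker hspan Q hQ hcQ)
  rintro x ⟨hx, hQx⟩
  have hPx : corrP μ D γ x = x := by
    rwa [hQdef, LinearMap.sub_apply, LinearMap.id_apply, sub_eq_zero] at hQx
  exact h μ hμ m X D h1 h2 γ hγ hrat hhodge x hx hPx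

/-- F3(d): `CruxComplexC ↔ Crux`. -/
theorem cruxComplexC_iff : CruxComplexC ↔ Crux := by
  constructor
  · intro h μ hμ m X D h1 h2 γ hγ P hrat hhodge c _ hPc
    exact h μ hμ m X D h1 h2 γ hγ hrat hhodge c hPc
  · intro h μ hμ m X D h1 h2 γ hγ hrat hhodge c hc
    exact fixed_mem_algebraicClasses_of_crux h μ hμ m X D h1 h2 γ hγ hrat hhodge c hc

/-- F3(d), reformulated: under the crux, the whole FIXED SUBSPACE `ker (P - 1)` of an admissible
`P` consists of algebraic classes. -/
theorem ker_sub_id_le_algebraicClasses_of_crux (h : Crux) (μ : OrientationFamily)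
    (hμ : μ.HasPoincareDuality) (m : ℕ) (X : Motives.SchemeOver ℂ)
    (D : UnitaryBallQuotientDatum (2 * (m + 1)) X) (h1 : 1 ≤ m) (h2 : m ≤ 2)
    (γ : complexBetti (X ⊗ X) (2 * (2 * (m + 1)))) (hγ : γ ∈ algebraicClasses (X ⊗ X) (2 * (m + 1)))
    (hrat : ∀ β, IsRationalClass β → IsRationalClass (corrP μ D γ β))
    (hhodge : ∀ β, IsOfHodgeType (2 * (m + 1)) X (2 * (m + 1)) (m + 1) (m + 1) (corrP μ D γ β)) :
    LinearMap.ker (corrP μ D γ - LinearMap.id) ≤ algebraicClasses X (m + 1) := by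
  intro c hc
  rw [LinearMap.mem_ker, LinearMap.sub_apply, LinearMap.id_apply, sub_eq_zero] at hc
  exact fixed_mem_algebraicClasses_of_crux h μ hμ m X D h1 h2 γ hγ hrat hhodge c hc

/-! ### §4 Floor: with an envelope the crux is middle-degree HC (F4) -/

/-- The SECTOR ENVELOPE (sector version of `SupersingularIsotypicLift.HodgeClassesEnveloped`): every
rational middle `(n,n)`-class is fixed by some admissible `P_γ`. Implied by HC on paper (HC on
`X × X` and `B ⟹ D` over `ℂ`, Lieberman 1968). -/
def MiddleEnveloped : Prop :=
  ∀ (μ : OrientationFamily), μ.HasPoincareDuality → ∀ (m : ℕ) (X : Motives.SchemeOver ℂ)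
    (D : UnitaryBallQuotientDatum (2 * (m + 1)) X), 1 ≤ m → m ≤ 2 →
    ∀ c : complexBetti X (2 * (m + 1)), IsRationalClass c →
      IsOfHodgeType (2 * (m + 1)) X (2 * (m + 1)) (m + 1) (m + 1) c →
        ∃ γ ∈ algebraicClasses (X ⊗ X) (2 * (m + 1)),
          (∀ β, IsRationalClass β → IsRationalClass (corrP μ D γ β)) ∧
          (∀ β, IsOfHodgeType (2 * (m + 1)) X (2 * (m + 1)) (m + 1) (m + 1) (corrP μ D γ β)) ∧
          corrP μ D γ c = c

/-- **F4: `Crux ∧ MiddleEnveloped ⟹ MiddleHC`.** Together with F1, over HC the crux, the envelope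
and `MiddleHC` are one statement: the crux is "HC for enveloped middle classes". -/
theorem middleHC_of_crux_of_middleEnveloped (h : Crux) (hE : MiddleEnveloped) : MiddleHC := by
  intro m X D h1 h2 c hc hH
  obtain ⟨γ, hγ, hrat, hhodge, hfix⟩ := hE μ₀ μ₀_hasPoincareDuality m X D h1 h2 c hc hH
  exact h μ₀ μ₀_hasPoincareDuality m X D h1 h2 γ hγ hrat hhodge c hc hfix

/-- **F4, the route's use**: with `OrthogonalEnveloped` (stmt-14300, rank 4) the crux makes every
rational `(n,n)`-class CUP-ORTHOGONAL to the theta world `TW(D) = SCⁿ ⊔ SConSpecial ⊔ Lefschetz`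
algebraic — the kernel half of `MiddleDegreeStep`. -/
theorem orthogonal_algebraic_of_crux (h : Crux) (hE : EndoscopicMiddleDegree.OrthogonalEnveloped)
    (μ : OrientationFamily) (hμ : μ.HasPoincareDuality) (m : ℕ) (X : Motives.SchemeOver ℂ)
    (D : UnitaryBallQuotientDatum (2 * (m + 1)) X) (h1 : 1 ≤ m) (h2 : m ≤ 2)
    (e : complexBetti X (2 * (m + 1))) (he : IsRationalClass e)
    (hH : IsOfHodgeType (2 * (m + 1)) X (2 * (m + 1)) (m + 1) (m + 1) e)
    (horth : ∀ x ∈ ((⨆ (W : Submodule D.E (Fin (2 * (m + 1) + 1) → D.E))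
        (_ : IsTotallyPositive (conjRingHom D.E) D.H W) (_ : Module.finrank D.E W = m + 1),
        classesSupportedOn X (D.specialSubvariety W) (2 * (m + 1))) ⊔
      (⨆ (W : Submodule D.E (Fin (2 * (m + 1) + 1) → D.E))
        (_ : IsTotallyPositive (conjRingHom D.E) D.H W) (_ : Module.finrank D.E W = m)
        (Z : Set X.left) (_ : IsClosed Z) (_ : Z ⊆ D.specialSubvariety W)
        (_ : ∀ z ∈ Z, ((m + 1 : ℕ) : ℕ∞) ≤ Order.coheight z), classesSupportedOn X Z (2 * (m + 1))) ⊔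
      Submodule.span ℂ {z : complexBetti X (2 * (m + 1)) | ∃ a : complexBetti X (2 * m),
        IsRationalClass a ∧ IsOfHodgeType (2 * (m + 1)) X (2 * m) m m a ∧
        ∃ d ∈ algebraicClasses X 1,
          z = cupProduct (two_mul_add_two_mul m 1) a d}),
      cupProduct (two_mul_add_two_mul (m + 1) (m + 1)) e x = 0) :
    e ∈ algebraicClasses X (m + 1) := by
  obtain ⟨γ, hγ, hrat, hhodge, hfix⟩ := hE μ hμ m X D h1 h2 e he hH horth
  exact h μ hμ m X D h1 h2 γ hγ hrat hhodge e he hfix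

/-! ### §5 Targets (lead's stuck stubs)
None yet (payload `stuck_stubs = []`). See the module docstring, M1/M2, for the two stub SHAPES that
are false in advance: "seeds for every Tate-type `π_f`" and "V-generality for every Tate-type `π_p`". -/

end Summit.HodgeConjecture.HodgeConjecture.Cruxes.IsotypicMiddleClassesAlgebraic.Disproof

end
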